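import Summits.BirchSwinnertonDyer.BirchSwinnertonDyer.Theorems.OneSidedTwistSqueezeX9KatoDivisibilityX9StubTestCocyclePkLevelX9InfResSurj
import Summits.BirchSwinnertonDyer.BirchSwinnertonDyer.Theorems.OneSidedTwistSqueezeX9KatoDivisibilityX9StubTestCocyclePkLevelX9Kummer
import Literature.NumberTheory.EllipticCurves.IwasawaTwistModPTower
import Literature.NumberTheory.EllipticCurves.KatoFineSelmerDual
import Literature.NumberTheory.EllipticCurves.PointDivisibilityProofs
import HarnessLib

/-!
# Crux `KatoDivisibilityX9` (stmt-BirchSwinnertonDyer-20547), line `graded_euler_loss`, stub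
# `stub_testCocyclePkLevelX9` (g5 wave 2), part 4: the ALGEBRAIC HALF of the level-`p^{d+1}` test cocycle
# — `Ψ`, `ψ̄` with `p^d Ψ = ι_* ψ̄` and `T^J ψ̄ ≠ 0`, from a test pair `(y, t)` through the dictionary

Seat `bsd-line-k6-p4` (prover-bsd-line-k6-p4-g5-0, stub worker A).  THEOREMS ONLY; `--supports
stmt-BirchSwinnertonDyer-20547` helper; closes nothing.

For an elliptic curve `W` over a number field `K`, an odd-or-not prime `p`, a `ℤ_p`-extension `κ` with
topological generator `γ` such that `E(K_∞)[p^∞]` has no `p`-torsion (hypothesis `hE`), `d : ℕ`, an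
equivariant `ι : E[p] → E[p^{d+1}]` inducing the inclusion of points, `J + 1 ≤ L`, and a test pair
`(y, t)` — `y ∈ H¹(K_∞, E[p])`, `t ∈ Sel₀(K_∞, E[p^∞])`, `ι_N y = p^d t`, `(conj_γ − 1)^L t = 0`,
`(conj_γ − 1)^J y ≠ 0` — `exists_testCocycle_algebraic` produces

* a cocycle `ψ` of `𝒯_L^{(d+1)}(E, κ⁻¹) = W.modPkTwist p (d+1) κ.invTwist L` and a class
  `ψ̄ ∈ H¹(K, W.modPTwist p κ.invTwist L)` with `p^d [ψ] = ι_* ψ̄` and `T^J ψ̄ ≠ 0`;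
* the coordinate cocycles `e_0, …, e_{L−1}` of `ψ` on `Γ_∞` with their recursion
  `e_i = γ·e_{i+1}(γ⁻¹·γ) − e_{i+1}` and `ι_{d+1} [e_i] = (conj_γ − id)^{L−1−i} t` (so every `e_i` is the
  Kummer lift of a FINE class) — the data the local analysis (parts 5–) consumes.

Mechanism: Kummer-lift `t` to `t̃ ∈ H¹(K_∞, E[p^{d+1}])` (`…Kummer`), `(conj_γ − 1)^L t̃ = 0` by
injectivity of `ι_{d+1}` (`hE`); the dictionary (`…InfRes`, `…InfResSurj`) turns `t̃` and `y` into
cocycles `ψ`, `ψ₁` of the level-`p^{d+1}` and mod-`p` inverse twists; `p^d[ψ] = ι_*[ψ₁]` because both have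
top coordinate class `p^d t̃ = ι_* y` (injectivity of the dictionary, `E(K_∞)[p^{d+1}] = 0`); `T^J[ψ₁] ≠ 0`
because the top coordinate of `S^J ψ₁` is `(conj_γ − 1)^J y ≠ 0`.

References: R. Greenberg, LNM 1716 (1999) §3 [GreenbergLNM1716]; B. Mazur, K. Rubin, Mem. AMS 799 (2004)
§5.3 [MazurRubin2004]; K. Kato, Astérisque 295 (2004) §13.8 [Kato2004Asterisque].
-/

set_option autoImplicit false
-- the summit and its single problem are both named `BirchSwinnertonDyer` (registry layout D-0017)
set_option linter.dupNamespace false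

noncomputable section

open scoped ContRepresentation
open Field Literature.NumberTheory.GaloisRepresentations Literature.NumberTheory.EllipticCurves
open WeierstrassCurve (geomTorsion geomPrimaryTorsion geomPoints)
open Summit.BirchSwinnertonDyer.BirchSwinnertonDyer.Theorems.OneSidedTwistSqueezeX9KatoDivisibilityX9StubTestCocyclePkLevelX9InfRes
open Summit.BirchSwinnertonDyer.BirchSwinnertonDyer.Theorems.OneSidedTwistSqueezeX9KatoDivisibilityX9StubTestCocyclePkLevelX9InfResSurj
open Summit.BirchSwinnertonDyer.BirchSwinnertonDyer.Theorems.OneSidedTwistSqueezeX9KatoDivisibilityX9StubTestCocyclePkLevelX9Kummer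

universe u

namespace Summit.BirchSwinnertonDyer.BirchSwinnertonDyer.Theorems.OneSidedTwistSqueezeX9KatoDivisibilityX9StubTestCocyclePkLevelX9Core

/-! ## Small generic facts -/

section Generic

variable {A : Type*} [AddCommGroup A]

/-- The iterates of an additive endomorphism minus the identity commute with `n •`. [folklore] -/
theorem iterate_sub_id_nsmul (f : A →+ A) (m n : ℕ) (x : A) :
    (⇑(f - AddMonoidHom.id A))^[m] (n • x) = n • (⇑(f - AddMonoidHom.id A))^[m] x := by
  induction m generalizing x with
  | zero => rfl
  | succ m ih => rw [Function.iterate_succ_apply, Function.iterate_succ_apply, ← ih, map_nsmul]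

/-- The iterates of an additive endomorphism minus the identity are additive: they kill `0`. [folklore] -/
theorem iterate_sub_id_zero (f : A →+ A) (m : ℕ) : (⇑(f - AddMonoidHom.id A))^[m] 0 = 0 := by
  induction m with
  | zero => rfl
  | succ m ih => rw [Function.iterate_succ_apply, map_zero, ih]

/-- The iterates of `f − id` preserve an `f`-stable subgroup. [folklore] -/
theorem iterate_sub_id_mem (f : A →+ A) (B : AddSubgroup A) (hB : ∀ x ∈ B, f x ∈ B) (m : ℕ) {x : A}
    (hx : x ∈ B) : (⇑(f - AddMonoidHom.id A))^[m] x ∈ B := by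
  induction m generalizing x with
  | zero => exact hx
  | succ m ih =>
    rw [Function.iterate_succ_apply]
    exact ih (B.sub_mem (hB x hx) hx)

end Generic

/-! ## The coordinate classes of a recursive family -/

section Coord

variable {K : Type u} [Field K] {p : ℕ} [Fact p.Prime] (κ : ZpExtension K p)
  {M : Type u} [AddCommGroup M] [DistribMulAction (absoluteGaloisGroup K) M]
  [TopologicalSpace M] [DiscreteTopology M] {L : ℕ}

/-- For a family `e_0, …, e_{L−1}` of cocycles on `Γ_∞` with `e_i = γ·e_{i+1}(γ⁻¹·γ) − e_{i+1}`, the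
classes are `[e_{L−1−j}] = (conj_γ − id)^[j] [e_{L−1}]`. [cite: SerreGaloisCohomology1997, I §2.5] -/
theorem coordClass_eq_iterate (γ : absoluteGaloisGroup K)
    (e : Fin L → contOneCocycles (discreteTopRep κ.kerSubgroup M))
    (he : ∀ (i : Fin L) (hi : (i : ℕ) + 1 < L),
      e i = conjCocycle κ.kerSubgroup γ (e ⟨(i : ℕ) + 1, hi⟩) - e ⟨(i : ℕ) + 1, hi⟩)
    (j : ℕ) (hj : j < L) :
    oneCocycleClass _ (e ⟨L - 1 - j, by omega⟩) =
      (⇑(conjH1 κ.kerSubgroup M γ - AddMonoidHom.id (subgroupH1 κ.kerSubgroup M)))^[j]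
        (oneCocycleClass _ (e ⟨L - 1, by omega⟩)) := by
  induction j with
  | zero => rfl
  | succ j ih =>
    rw [Function.iterate_succ_apply', ← ih (by omega)]
    have hlt : L - 1 - (j + 1) < L := by omega
    have hi : ((⟨L - 1 - (j + 1), hlt⟩ : Fin L) : ℕ) + 1 < L := by simp; omega
    have key := he ⟨L - 1 - (j + 1), hlt⟩ hi
    have hidx : (⟨((⟨L - 1 - (j + 1), hlt⟩ : Fin L) : ℕ) + 1, hi⟩ : Fin L) = ⟨L - 1 - j, by omega⟩ :=
      Fin.ext (by simp; omega)
    rw [hidx] at key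
    rw [key, oneCocycleClass_sub, AddMonoidHom.sub_apply, AddMonoidHom.id_apply, conjH1_oneCocycleClass]

/-- If a cocycle of `X` is a coboundary, so is each of its coordinate cocycles on `Γ_∞`
(for `Γ_∞` acting coordinatewise). [cite: SerreGaloisCohomology1997, I §2.6] -/
theorem coordClass_eq_zero_of_oneCocycleClass_eq_zero (X : DiscreteGaloisModule K (Fin L → M))
    (hX : ∀ τ ∈ κ.kerSubgroup, ∀ x : Fin L → M, X τ x = fun i => τ • x i)
    (φ : contOneCocycles X.toTopRep) (hφ : oneCocycleClass X.toTopRep φ = 0) (i : Fin L)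
    (e : contOneCocycles (discreteTopRep κ.kerSubgroup M))
    (he : ∀ τ : κ.kerSubgroup, e.1 τ = φ.1 (τ : absoluteGaloisGroup K) i) :
    oneCocycleClass _ e = 0 := by
  obtain ⟨v, hv⟩ := (oneCocycleClass_eq_zero_iff _ _).1 hφ
  rw [oneCocycleClass_eq_zero_iff]
  refine ⟨v i, fun τ => ?_⟩
  rw [he]
  have h1 := congrFun (hv (τ : absoluteGaloisGroup K)) i
  rw [h1]
  change (X (τ : absoluteGaloisGroup K) v - v) i = (τ : absoluteGaloisGroup K) • v i - v i
  rw [hX _ τ.2]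
  rfl

end Coord

/-! ## The algebraic half of the test cocycle -/

section Main

variable {K : Type u} [Field K] [NumberField K] (W : WeierstrassCurve K) [W.IsElliptic]
  (p : ℕ) [Fact p.Prime] (κ : ZpExtension K p)

omit [NumberField K] [W.IsElliptic] [Fact p.Prime] in
/-- `ι_1 = torsionToPrimaryH1Sub` is injective when `E[p^∞]^H` has no `p`-torsion (the tree's
`torsionToPrimaryH1Sub_injective_of_fixed`, universe-polymorphic copy). [cite: GreenbergLNM1716, §5 p. 114] -/
theorem torsionToPrimaryH1Sub_injective_of_fixed' (H : Subgroup (absoluteGaloisGroup K))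
    (hH : ∀ m : geomPrimaryTorsion W p, (∀ σ ∈ H, σ • m = m) → p • m = 0 → m = 0) :
    Function.Injective (W.torsionToPrimaryH1Sub p H) := by
  have hfix : ∀ m : geomPrimaryTorsion W p, (∀ σ ∈ H, σ • m = m) → m = 0 := by
    intro m hm
    by_contra h0
    obtain ⟨j, hne, hpj⟩ := W.exists_pow_smul_ne_zero_and_p_smul_eq_zero h0
    exact hne (hH _ (fun σ hσ => by rw [smul_comm, hm σ hσ]) hpj)
  rw [injective_iff_map_eq_zero]
  intro y hy
  obtain ⟨φ, rfl⟩ := oneCocycleClass_surjective _ y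
  rw [W.torsionToPrimaryH1Sub_oneCocycleClass, oneCocycleClass_eq_zero_iff] at hy
  obtain ⟨a, ha⟩ := hy
  have ha' : ∀ σ : H, AddSubgroup.inclusion (WeierstrassCurve.geomTorsion_le_geomPrimaryTorsion W p) (φ.1 σ) =
      (σ : absoluteGaloisGroup K) • a - a := fun σ => ha σ
  have hval : ∀ σ : H, p • φ.1 σ = 0 := fun σ => by
    apply Subtype.ext
    rw [AddSubgroupClass.coe_nsmul, ZeroMemClass.coe_zero]
    exact AddSubgroup.torsionBy.nsmul_iff.mp (φ.1 σ).2
  have hpa : ∀ σ ∈ H, σ • (p • a) = p • a := fun σ hσ => by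
    rw [← sub_eq_zero, smul_comm, ← smul_sub, ← ha' ⟨σ, hσ⟩, ← map_nsmul, hval, map_zero]
  have hpa0 : p • a = 0 := hfix _ hpa
  have hamem : ((a : geomPrimaryTorsion W p) : geomPoints W) ∈ geomTorsion W (p : ℤ) :=
    AddSubgroup.torsionBy.nsmul_iff.mpr (by rw [← AddSubgroupClass.coe_nsmul, hpa0, ZeroMemClass.coe_zero])
  refine (oneCocycleClass_eq_zero_iff _ φ).mpr ⟨⟨_, hamem⟩, fun σ => ?_⟩
  apply AddSubgroup.inclusion_injective (WeierstrassCurve.geomTorsion_le_geomPrimaryTorsion W p)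
  rw [ha', map_sub]
  rfl

omit [NumberField K] [W.IsElliptic] [Fact p.Prime] in
/-- `ι_1` commutes with the iterates of `conj_γ − id`. [cite: NeukirchSchmidtWingberg2008, I.§5] -/
theorem iterate_conjH1_sub_torsionToPrimaryH1Sub (H : Subgroup (absoluteGaloisGroup K)) [H.Normal]
    (γ : absoluteGaloisGroup K) (m : ℕ)
    (z : Literature.NumberTheory.EllipticCurves.subgroupH1 H (geomTorsion W (p : ℤ))) :
    W.torsionToPrimaryH1Sub p H
        ((⇑(Literature.NumberTheory.EllipticCurves.conjH1 H (geomTorsion W (p : ℤ)) γ -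
          AddMonoidHom.id (Literature.NumberTheory.EllipticCurves.subgroupH1 H (geomTorsion W (p : ℤ)))))^[m] z) =
      (⇑(W.conjH1 p H γ - AddMonoidHom.id (W.subgroupH1 p H)))^[m] (W.torsionToPrimaryH1Sub p H z) := by
  induction m generalizing z with
  | zero => rfl
  | succ m ih =>
    rw [Function.iterate_succ_apply', Function.iterate_succ_apply', ← ih, AddMonoidHom.sub_apply,
      AddMonoidHom.sub_apply, AddMonoidHom.id_apply, AddMonoidHom.id_apply, map_sub,
      W.conjH1_torsionToPrimaryH1Sub]

set_option maxHeartbeats 400000 in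
/-- **The algebraic half of the level-`p^{d+1}` test cocycle** (see the module docstring).  The twists
are written in the `ZpExtension.twistModPk` / `twistModP` spelling, definitionally equal to
`W.modPkTwist p (d+1) κ.invTwist L` / `W.modPTwist p κ.invTwist L`.
[cite: Kato2004Asterisque, §13.8 (pp. 228–229) (shape)] [cite: GreenbergLNM1716, §3 Lemma 3.2] -/
theorem exists_testCocycle_algebraic {γ : absoluteGaloisGroup K} (hγ : κ.IsTopGenerator γ)
    (hE : ∀ m : geomPrimaryTorsion W p, (∀ σ ∈ κ.kerSubgroup, σ • m = m) → p • m = 0 → m = 0)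
    (d : ℕ)
    (ι : (W.torsionGaloisModule (p : ℤ)).toContRepresentation →ⁱL
      (W.torsionGaloisModule ((p : ℤ) ^ (d + 1))).toContRepresentation)
    (hι : ∀ P : geomTorsion W (p : ℤ),
      ((ι P : geomTorsion W ((p : ℤ) ^ (d + 1))) : geomPoints W) = (P : geomPoints W))
    (L J : ℕ) (hJL : J + 1 ≤ L)
    (y : Literature.NumberTheory.EllipticCurves.subgroupH1 κ.kerSubgroup (geomTorsion W (p : ℤ)))
    (t : W.fineSelmerInfty κ)
    (hyt : W.torsionToPrimaryH1Sub p κ.kerSubgroup y = p ^ d • (t : W.subgroupH1 p κ.kerSubgroup))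
    (htL : (⇑(W.conjH1 p κ.kerSubgroup γ - AddMonoidHom.id (W.subgroupH1 p κ.kerSubgroup)))^[L]
      (t : W.subgroupH1 p κ.kerSubgroup) = 0)
    (hyJ : (⇑(Literature.NumberTheory.EllipticCurves.conjH1 κ.kerSubgroup (geomTorsion W (p : ℤ)) γ -
      AddMonoidHom.id (Literature.NumberTheory.EllipticCurves.subgroupH1 κ.kerSubgroup
        (geomTorsion W (p : ℤ)))))^[J] y ≠ 0) :
    ∃ (ψ : contOneCocycles (κ.invTwist.twistModPk (W.torsionGaloisModule ((p : ℤ) ^ (d + 1)))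
        (W.pow_nsmul_geomTorsion_eq_zero p (d + 1)) L).toTopRep)
      (ψb : galoisCohomology (κ.invTwist.twistModP (W.torsionGaloisModule (p : ℤ))
        (fun P : geomTorsion W (p : ℤ) => AddSubgroup.torsionBy.nsmul P) L) 1)
      (e : Fin L → contOneCocycles (discreteTopRep κ.kerSubgroup (geomTorsion W ((p : ℤ) ^ (d + 1))))),
      p ^ d • (oneCocycleClass _ ψ : galoisCohomology (κ.invTwist.twistModPk
          (W.torsionGaloisModule ((p : ℤ) ^ (d + 1))) (W.pow_nsmul_geomTorsion_eq_zero p (d + 1)) L) 1) =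
        galoisCohomology.map
          (κ.invTwist.twistModPToModPk (W.torsionGaloisModule (p : ℤ)) L
            (W.torsionGaloisModule ((p : ℤ) ^ (d + 1)))
            (fun P : geomTorsion W (p : ℤ) => AddSubgroup.torsionBy.nsmul P)
            (W.pow_nsmul_geomTorsion_eq_zero p (d + 1)) ι) 1 ψb ∧
      (κ.invTwist.shiftH1 (W.torsionGaloisModule (p : ℤ))
          (fun P : geomTorsion W (p : ℤ) => AddSubgroup.torsionBy.nsmul P) L)^[J] ψb ≠ 0 ∧
      (∀ i : Fin L, resH1Hom (ContinuousMonoidHom.id κ.kerSubgroup)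
          (AddSubgroup.inclusion (pkTorsion_le_geomPrimaryTorsion W p (d + 1))) (fun _ _ => rfl)
          (oneCocycleClass _ (e i)) =
        (⇑(W.conjH1 p κ.kerSubgroup γ - AddMonoidHom.id (W.subgroupH1 p κ.kerSubgroup)))^[L - 1 - i]
          (t : W.subgroupH1 p κ.kerSubgroup)) ∧
      (∀ (i : Fin L) (hi : (i : ℕ) + 1 < L),
        e i = conjCocycle κ.kerSubgroup γ (e ⟨(i : ℕ) + 1, hi⟩) - e ⟨(i : ℕ) + 1, hi⟩) ∧
      ∀ (τ : κ.kerSubgroup) (i : Fin L), ψ.1 (τ : absoluteGaloisGroup K) i = (e i).1 τ := by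
  have hp : p.Prime := Fact.out
  have hL : 0 < L := by omega
  -- the dictionary hypotheses for `X = 𝒯_L^{(d+1)}(E, κ⁻¹)` and `X₁ = 𝒯_L(E[p], κ⁻¹)`
  have hX : ∀ τ ∈ κ.kerSubgroup, ∀ x : Fin L → geomTorsion W ((p : ℤ) ^ (d + 1)),
      κ.invTwist.twistModPk (W.torsionGaloisModule ((p : ℤ) ^ (d + 1)))
        (W.pow_nsmul_geomTorsion_eq_zero p (d + 1)) L τ x = fun i => τ • x i :=
    fun τ hτ x => modPkTwist_invTwist_apply_of_mem_kerSubgroup W p (d + 1) κ L hτ x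
  have hγS : ∀ x : Fin L → geomTorsion W ((p : ℤ) ^ (d + 1)),
      κ.invTwist.twistModPk (W.torsionGaloisModule ((p : ℤ) ^ (d + 1)))
          (W.pow_nsmul_geomTorsion_eq_zero p (d + 1)) L γ x +
        shiftEnd (geomTorsion W ((p : ℤ) ^ (d + 1))) L
          (κ.invTwist.twistModPk (W.torsionGaloisModule ((p : ℤ) ^ (d + 1)))
            (W.pow_nsmul_geomTorsion_eq_zero p (d + 1)) L γ x) = fun i => γ • x i :=
    fun x => modPkTwist_invTwist_add_shiftEnd_of_isTopGenerator W p (d + 1) κ L hγ x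
  have hX₁ : ∀ τ ∈ κ.kerSubgroup, ∀ x : Fin L → geomTorsion W (p : ℤ),
      κ.invTwist.twistModP (W.torsionGaloisModule (p : ℤ))
        (fun P : geomTorsion W (p : ℤ) => AddSubgroup.torsionBy.nsmul P) L τ x = fun i => τ • x i :=
    fun τ hτ x => modPTwist_invTwist_apply_of_mem_kerSubgroup W p κ L hτ x
  have hγS₁ : ∀ x : Fin L → geomTorsion W (p : ℤ),
      κ.invTwist.twistModP (W.torsionGaloisModule (p : ℤ))
          (fun P : geomTorsion W (p : ℤ) => AddSubgroup.torsionBy.nsmul P) L γ x +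
        shiftEnd (geomTorsion W (p : ℤ)) L (κ.invTwist.twistModP (W.torsionGaloisModule (p : ℤ))
          (fun P : geomTorsion W (p : ℤ) => AddSubgroup.torsionBy.nsmul P) L γ x) = fun i => γ • x i :=
    fun x => modPTwist_invTwist_add_shiftEnd_of_isTopGenerator W p κ L hγ x
  have hMk : ∀ P : geomTorsion W ((p : ℤ) ^ (d + 1)), p ^ (d + 1) • P = 0 :=
    W.pow_nsmul_geomTorsion_eq_zero p (d + 1)
  have hM1 : ∀ P : geomTorsion W (p : ℤ), p ^ 1 • P = 0 := fun P => by
    rw [pow_one]; exact AddSubgroup.torsionBy.nsmul P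
  -- no `Γ_∞`-fixed points
  have hfix : ∀ m : geomPrimaryTorsion W p, (∀ σ ∈ κ.kerSubgroup, σ • m = m) → m = 0 := by
    intro m hm
    by_contra h0
    obtain ⟨j, hne, hpj⟩ := W.exists_pow_smul_ne_zero_and_p_smul_eq_zero h0
    exact hne (hE _ (fun σ hσ => by rw [smul_comm, hm σ hσ]) hpj)
  have hM0 : ∀ P : geomTorsion W ((p : ℤ) ^ (d + 1)), (∀ τ ∈ κ.kerSubgroup, τ • P = P) → P = 0 := by
    intro P hP
    have h := hfix (AddSubgroup.inclusion (pkTorsion_le_geomPrimaryTorsion W p (d + 1)) P)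
      (fun σ hσ => by
        apply Subtype.ext
        change σ • (P : geomPoints W) = (P : geomPoints W)
        exact congrArg Subtype.val (hP σ hσ))
    exact AddSubgroup.inclusion_injective _ (by rw [h, map_zero])
  have hinjk := resH1Hom_pkTorsion_injective_of_fixed W p (d + 1) κ.kerSubgroup hE
  have hinj₁ := torsionToPrimaryH1Sub_injective_of_fixed' W p κ.kerSubgroup hE
  -- (1) `y` is `p`-torsion, hence `p^{d+1} t = 0`; Kummer-lift `t` to `t̃ ∈ H¹(K_∞, E[p^{d+1}])`
  obtain ⟨c₁, hc₁⟩ := oneCocycleClass_surjective _ y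
  have hpy : p • y = 0 := by
    rw [← hc₁]
    exact nsmul_oneCocycleClass_eq_zero c₁ p fun g => AddSubgroup.torsionBy.nsmul (c₁.1 g)
  have hpt : p ^ (d + 1) • (t : W.subgroupH1 p κ.kerSubgroup) = 0 := by
    rw [pow_succ', mul_smul, ← hyt, ← map_nsmul, hpy, map_zero]
  obtain ⟨tk, htk⟩ :=
    exists_resH1Hom_pkTorsion_eq W p (d + 1) κ.kerSubgroup W.zsmul_geomPoints_surjective_holds hpt
  -- `(conj_γ − id)^L t̃ = 0` by injectivity of `ι_{d+1}`
  obtain ⟨c, hc⟩ := oneCocycleClass_surjective _ tk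
  have htkL : (⇑(Literature.NumberTheory.EllipticCurves.conjH1 κ.kerSubgroup
      (geomTorsion W ((p : ℤ) ^ (d + 1))) γ -
        AddMonoidHom.id (Literature.NumberTheory.EllipticCurves.subgroupH1 κ.kerSubgroup
          (geomTorsion W ((p : ℤ) ^ (d + 1))))))^[L] (oneCocycleClass _ c) = 0 := by
    rw [hc]
    apply hinjk
    rw [map_zero, ← iterate_conjH1_sub_resH1Hom_pkTorsion, htk, htL]
  -- (2) the dictionary at level `p^{d+1}`: the cocycle `ψ` with coordinates `e`
  obtain ⟨ψ, e, he_top, he_rec, hψe⟩ := exists_cocycle_of_iterate_conjH1_sub_eq_zero κ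
    (κ.invTwist.twistModPk (W.torsionGaloisModule ((p : ℤ) ^ (d + 1)))
      (W.pow_nsmul_geomTorsion_eq_zero p (d + 1)) L) hX hγ hγS hMk hL c htkL
  -- (3) `(conj_γ − id)^L y = 0` (injectivity of `ι_1`); the dictionary at level `p`: `ψ₁`, `e₁`
  have hyL : (⇑(Literature.NumberTheory.EllipticCurves.conjH1 κ.kerSubgroup (geomTorsion W (p : ℤ)) γ -
      AddMonoidHom.id (Literature.NumberTheory.EllipticCurves.subgroupH1 κ.kerSubgroup
        (geomTorsion W (p : ℤ)))))^[L] (oneCocycleClass _ c₁) = 0 := by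
    rw [hc₁]
    apply hinj₁
    rw [map_zero, iterate_conjH1_sub_torsionToPrimaryH1Sub, hyt, iterate_sub_id_nsmul, htL, smul_zero]
  obtain ⟨ψ₁, e₁, he₁_top, he₁_rec, hψe₁⟩ := exists_cocycle_of_iterate_conjH1_sub_eq_zero κ
    (κ.invTwist.twistModP (W.torsionGaloisModule (p : ℤ))
      (fun P : geomTorsion W (p : ℤ) => AddSubgroup.torsionBy.nsmul P) L) hX₁ hγ hγS₁ hM1 hL c₁ hyL
  -- the classes of the coordinates
  have hcoord : ∀ i : Fin L, resH1Hom (ContinuousMonoidHom.id κ.kerSubgroup)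
      (AddSubgroup.inclusion (pkTorsion_le_geomPrimaryTorsion W p (d + 1))) (fun _ _ => rfl)
      (oneCocycleClass _ (e i)) =
      (⇑(W.conjH1 p κ.kerSubgroup γ - AddMonoidHom.id (W.subgroupH1 p κ.kerSubgroup)))^[L - 1 - i]
        (t : W.subgroupH1 p κ.kerSubgroup) := by
    have hcoord' : ∀ (j : ℕ) (hj : j < L), resH1Hom (ContinuousMonoidHom.id κ.kerSubgroup)
        (AddSubgroup.inclusion (pkTorsion_le_geomPrimaryTorsion W p (d + 1))) (fun _ _ => rfl)
        (oneCocycleClass _ (e ⟨L - 1 - j, by omega⟩)) =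
        (⇑(W.conjH1 p κ.kerSubgroup γ - AddMonoidHom.id (W.subgroupH1 p κ.kerSubgroup)))^[j]
          (t : W.subgroupH1 p κ.kerSubgroup) := by
      intro j hj
      rw [coordClass_eq_iterate κ γ e he_rec j hj, ← iterate_conjH1_sub_resH1Hom_pkTorsion, he_top, hc, htk]
    intro i
    have h := hcoord' (L - 1 - i) (by omega)
    have hidx : (⟨L - 1 - (L - 1 - (i : ℕ)), (by omega : L - 1 - (L - 1 - (i : ℕ)) < L)⟩ : Fin L) = i :=
      Fin.ext (by simp; omega)
    rw [hidx] at h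
    exact h
  refine ⟨ψ, oneCocycleClass _ ψ₁, e, ?_, ?_, hcoord, he_rec, hψe⟩
  · -- (a) `p^d [ψ] = ι_* [ψ₁]`: both have top coordinate class `p^d t̃ = ι_* y`
    rw [ZpExtension.map_oneCocycleClass_twist, ← Nat.cast_smul_eq_nsmul ℤ, ← oneCocycleClass_smul,
      ← sub_eq_zero, ← oneCocycleClass_sub]
    -- the difference cocycle has top coordinate `p^d c − ι ∘ c₁`, a coboundary on `Γ_∞`
    obtain ⟨eD, heD⟩ := exists_coordCocycle κ
      (κ.invTwist.twistModPk (W.torsionGaloisModule ((p : ℤ) ^ (d + 1)))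
        (W.pow_nsmul_geomTorsion_eq_zero p (d + 1)) L) hX
      (((p ^ d : ℕ) : ℤ) • ψ -
        κ.invTwist.pushCocycle (W.torsionGaloisModule (p : ℤ))
          (fun P : geomTorsion W (p : ℤ) => AddSubgroup.torsionBy.nsmul P) L
          (κ.invTwist.twistModPToModPk (W.torsionGaloisModule (p : ℤ)) L
            (W.torsionGaloisModule ((p : ℤ) ^ (d + 1)))
            (fun P : geomTorsion W (p : ℤ) => AddSubgroup.torsionBy.nsmul P)
            (W.pow_nsmul_geomTorsion_eq_zero p (d + 1)) ι) ψ₁)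
      ⟨L - 1, Nat.sub_lt hL Nat.one_pos⟩
    have heD' : ∀ τ : κ.kerSubgroup, eD.1 τ = p ^ d • c.1 τ - ι (c₁.1 τ) := by
      intro τ
      rw [heD]
      change ((p ^ d : ℕ) : ℤ) • ψ.1 (τ : absoluteGaloisGroup K) ⟨L - 1, Nat.sub_lt hL Nat.one_pos⟩ -
        ι (ψ₁.1 (τ : absoluteGaloisGroup K) ⟨L - 1, Nat.sub_lt hL Nat.one_pos⟩) = _
      rw [hψe, hψe₁, he_top, he₁_top, natCast_zsmul]
    have hclass : oneCocycleClass _ eD = 0 := by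
      apply hinjk
      rw [map_zero]
      have h1 : resH1Hom (ContinuousMonoidHom.id κ.kerSubgroup)
          (AddSubgroup.inclusion (pkTorsion_le_geomPrimaryTorsion W p (d + 1))) (fun _ _ => rfl)
          (oneCocycleClass _ eD) =
        p ^ d • resH1Hom (ContinuousMonoidHom.id κ.kerSubgroup)
          (AddSubgroup.inclusion (pkTorsion_le_geomPrimaryTorsion W p (d + 1))) (fun _ _ => rfl)
          (oneCocycleClass _ c) - W.torsionToPrimaryH1Sub p κ.kerSubgroup (oneCocycleClass _ c₁) := by
        rw [resH1Hom_id_oneCocycleClass, resH1Hom_id_oneCocycleClass,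
          W.torsionToPrimaryH1Sub_oneCocycleClass, ← Nat.cast_smul_eq_nsmul ℤ, ← oneCocycleClass_smul,
          ← oneCocycleClass_sub]
        congr 1
        refine Subtype.ext (ContinuousMap.ext fun τ => Subtype.ext ?_)
        change ((AddSubgroup.inclusion (pkTorsion_le_geomPrimaryTorsion W p (d + 1)) (eD.1 τ) :
            geomPrimaryTorsion W p) : geomPoints W) =
          ((((p ^ d : ℕ) : ℤ) • AddSubgroup.inclusion (pkTorsion_le_geomPrimaryTorsion W p (d + 1)) (c.1 τ) -
              AddSubgroup.inclusion (WeierstrassCurve.geomTorsion_le_geomPrimaryTorsion W p) (c₁.1 τ) :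
            geomPrimaryTorsion W p) : geomPoints W)
        rw [heD', AddSubgroup.coe_inclusion, AddSubgroupClass.coe_sub, AddSubgroupClass.coe_nsmul, hι,
          AddSubgroupClass.coe_sub, AddSubgroupClass.coe_zsmul, AddSubgroup.coe_inclusion,
          AddSubgroup.coe_inclusion, natCast_zsmul]
      rw [h1, hc, htk, hc₁, hyt, sub_self]
    obtain ⟨v, hv⟩ := (oneCocycleClass_eq_zero_iff _ _).1 hclass
    exact oneCocycleClass_eq_zero_of_topCoord κ _ hX hγS hM0 hL _
      ⟨v, fun τ hτ => by rw [← heD ⟨τ, hτ⟩]; exact hv ⟨τ, hτ⟩⟩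
  · -- (b) `T^J [ψ₁] ≠ 0`: the top coordinate of `S^J ψ₁` is `e₁_{L-1-J}`, of class `(conj_γ − id)^J y ≠ 0`
    intro h0
    rw [ZpExtension.shiftH1_iterate_oneCocycleClass] at h0
    have hJL' : L - 1 - J < L := by omega
    have hzero := coordClass_eq_zero_of_oneCocycleClass_eq_zero κ _ hX₁ _ h0
      ⟨L - 1, Nat.sub_lt hL Nat.one_pos⟩ (e₁ ⟨L - 1 - J, hJL'⟩) fun τ => by
        rw [ZpExtension.shiftPowCocycle_apply, shiftEnd_pow_apply, dif_neg (by simp; omega), hψe₁]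
    apply hyJ
    rw [← hc₁, ← he₁_top, ← coordClass_eq_iterate κ γ e₁ he₁_rec J (by omega)]
    exact hzero

end Main

end Summit.BirchSwinnertonDyer.BirchSwinnertonDyer.Theorems.OneSidedTwistSqueezeX9KatoDivisibilityX9StubTestCocyclePkLevelX9Core

end
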